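import Literature.Probability.Percolation.CutBlocksWalls
import Literature.Probability.Percolation.CollarWindowOriented
import HarnessLib

/-!
# Clean straight windows on the flat stretches of the zones of a cut

Topic `Probability/Percolation`.  Support file (proofs, no named fact) for the named fact
`SchrammSmirnov2011_thm_1_7` (zone geometry of the proof of Prop. 4.1, Ann. Probab. 39 (2011), §4):
across a flat stretch of the upper inner wall of `CutBlocks.zones` (`CutBlocks.FlatTop`), the
collar datum of the zones, translated down by the index `r₀ = ⌊s(z.2+1)/δ⌋ + 1` of the first
collar row, has a CLEAN STRAIGHT WINDOW (`CollarDatum.CleanWindow`, `CollarWindowArms.lean`) at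
every position whose box fits in the three columns of the stretch (`cleanWindow_of_flatTop`), for
meshes with `δ (R₁ + 4) ≤ s`.  This is the input of the landing bound
`CollarDatum.real_patternAt_le_two_factor` (`CollarWindowLandings.lean`) along the bulk of the walls.

## References

* O. Schramm, S. Smirnov, *On the scaling limits of planar percolation*, Ann. Probab. 39 (2011)
  1768–1814, arXiv:1101.5820, §4, proof of Prop. 4.1. [SchrammSmirnov2011]
-/

noncomputable section

open Set Metric
open Literature.Probability.LatticeModels

namespace Literature.Probability.Percolation

namespace CutBlocks

variable {s : ℝ} {α : Set ℂ} {δ : ℝ}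

/-- The index of the first collar row above the top edge of the blocks at level `z₂`. [folklore] -/
def firstRow (s δ : ℝ) (z₂ : ℤ) : ℤ := ⌊s * (z₂ + 1) / δ⌋ + 1

/-- A site lies strictly above the top edge iff its row index is at least the first collar row. [folklore] -/
theorem lt_mul_iff_firstRow_le (hδ : 0 < δ) (z₂ r : ℤ) : s * (z₂ + 1) < δ * r ↔ firstRow s δ z₂ ≤ r := by
  rw [firstRow, Int.add_one_le_iff, Int.floor_lt, div_lt_iff₀ hδ, mul_comm (r : ℝ) δ]

/-- The translation bringing the first collar row to row `0`. [folklore] -/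
def downShift (s δ : ℝ) (z₂ : ℤ) : Seeded.LatticeSym := Seeded.LatticeSym.shift (Pi.single 1 (-firstRow s δ z₂))

/-- The translation in coordinates. [folklore] -/
theorem downShift_apply (z₂ : ℤ) (v : Site 2) :
    (downShift s δ z₂).σ v = v + Pi.single 1 (-firstRow s δ z₂) := rfl

/-- **Clean straight windows on a flat stretch.** [cite: SchrammSmirnov2011, §4, proof of Prop. 4.1 ("each component K_j is a quad with two long sides on β and β'")] -/
theorem cleanWindow_of_flatTop (hs : 0 < s) (hδ : 0 < δ) (hα : Bornology.IsBounded α) {z : ℤ × ℤ}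
    (hz : FlatTop s α z) {j : ℤ} {m R₁ : ℕ} (hcol₁ : s * (z.1 - 1) < δ * (j - R₁ - 2))
    (hcol₂ : δ * (j + m + R₁ + 2) < s * (z.1 + 2)) (h2δ : 2 * δ ≤ s) (hR₁ : δ * (R₁ + 4) ≤ s) :
    ((zones hs hδ hα).collar.map (downShift s δ z.2)).CleanWindow j m R₁ := by
  intro w hw0 hw0' hw1 hw1'
  set r₀ := firstRow s δ z.2 with hr₀
  -- the original site
  set v : Site 2 := w + Pi.single 1 r₀ with hv
  have hwv : w = (downShift s δ z.2).σ v := by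
    rw [downShift_apply, hv, add_assoc, ← Pi.single_add]; simp [hr₀]
  have hv0 : v 0 = w 0 := by simp [hv]
  have hv1 : v 1 = w 1 + r₀ := by simp [hv]
  -- the range hypotheses of the flat-top pattern
  have hx1 : (⌊s * (z.2 + 1) / δ⌋ : ℝ) ≤ s * (z.2 + 1) / δ := Int.floor_le _
  have hx2 : s * (z.2 + 1) / δ < (⌊s * (z.2 + 1) / δ⌋ : ℝ) + 1 := Int.lt_floor_add_one _
  have hr₀R : (r₀ : ℝ) = (⌊s * (z.2 + 1) / δ⌋ : ℝ) + 1 := by rw [hr₀, firstRow]; push_cast; ring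
  have hδr₀ : s * (z.2 + 1) < δ * r₀ ∧ δ * r₀ ≤ s * (z.2 + 1) + δ := by
    rw [hr₀R]
    rw [div_lt_iff₀ hδ] at hx2
    rw [le_div_iff₀ hδ] at hx1
    constructor <;> nlinarith
  have h1 : s * (z.1 - 1) < δ * v 0 := by
    rw [hv0]
    have : δ * ((j : ℝ) - R₁ - 2) ≤ δ * (w 0 : ℝ) := mul_le_mul_of_nonneg_left (by exact_mod_cast hw0) hδ.le
    linarith
  have h2 : δ * v 0 < s * (z.1 + 2) := by
    rw [hv0]
    have : δ * (w 0 : ℝ) ≤ δ * ((j : ℝ) + m + R₁ + 2) := mul_le_mul_of_nonneg_left (by exact_mod_cast hw0') hδ.le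
    linarith
  have h3 : s * z.2 ≤ δ * v 1 := by
    rw [hv1]; push_cast
    have : δ * (-2 : ℝ) ≤ δ * (w 1 : ℝ) := mul_le_mul_of_nonneg_left (by exact_mod_cast hw1) hδ.le
    nlinarith [hδr₀.1]
  have h4 : δ * v 1 < s * (z.2 + 2) := by
    rw [hv1]; push_cast
    have : δ * (w 1 : ℝ) ≤ δ * ((R₁ : ℝ) + 2) := mul_le_mul_of_nonneg_left (by exact_mod_cast hw1') hδ.le
    nlinarith [hδr₀.2]
  have hK : w ∈ ((zones hs hδ hα).collar.map (downShift s δ z.2)).K ↔ v ∈ (zones hs hδ hα).collar.K := by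
    rw [hwv]; exact Seeded.CollarDatum.mem_map_K_iff
  have hF : w ∈ ((zones hs hδ hα).collar.map (downShift s δ z.2)).Far ↔ v ∈ (zones hs hδ hα).collar.Far := by
    rw [hwv]; exact Seeded.CollarDatum.mem_map_Far_iff
  constructor
  · rw [hK, Seeded.Zones.collar_K, mem_zones_K,
      mem_Kset_iff_of_flatTop hs hz h1 h2 h3 h4, lt_mul_iff_firstRow_le hδ, ← hr₀, hv1]
    omega
  · rw [hF, Seeded.Zones.collar_Far]
    rintro ⟨hK, hN, -⟩
    rcases mem_Nset_or_Kset_of_flatTop hs hz h1 h2 h3 h4 with h | h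
    · exact hN ((mem_zones_N hs hδ hα).2 h)
    · exact hK ((mem_zones_K hs hδ hα).2 h)

end CutBlocks

end Literature.Probability.Percolation

end
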